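import Summits.CriticalPhenomena.PercolationContinuityZ3.Theorems.PercNearOneGluingNoHeavyQuantGluedTransfer
import Summits.CriticalPhenomena.PercolationContinuityZ3.Theorems.PercNearOneGluingNoHeavyQuantNoGiantClosure
import HarnessLib

/-!
# QUANT lane R8, T-DEC: DEEP TRANSFER for the glued-piece slice — every component of the first factor whose top lies at or below `j − r − k`
# transfers (typer g23's no-giant convolution closure `lconv_decAtT_noGiant` + `decAtT_glued`); hence the pair conditions of the single-layer
# route to `LawDec.GluedDominated` hold for EVERY deep mid pair, light or heavy, with the pullback itself (arm-1 gen 58, architect)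

builds on p205010 (kernel theorem, internal audit signed; external expert review pending)

Support file (`--supports stmt-CriticalPhenomena-4575`), QUANT lane seat prim-quant-arm-1 (gen 58, architect); memo
`run/shared/lean/prim/quant/prim-quant-arm-1-g58/ARCH-G58.md` §2.  Theorems only; standard axioms, no sorries, no definitions.  Companion of
`…QuantGluedTransfer` (absorber half, heavy pairs, giant pairs, window atoms).

THE OBSERVATION.  In the no-giant regime DEC at explicit targets is closed under convolution with ADDITION OF TARGETS (`lconv_decAtT_noGiant`, typer g23,
from BLOB-DEC(2) + `LightTwoBlobDEC` + `LightLightTwoBlobDEC`).  The glued law `t = {0: 1−q, r: q(1−g), r+k: qg}` is DEC at `(y, Δ)` for every `Δ ≤ m`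
at every layer (`decAtT_glued`).  Hence for ANY law `C` on `{0..h}` that is DEC at `(y, T₀)` without giants (layer `h`) and any layer `j ≥ h + r + k`
("DEEP"), the image `C ∗ t` is DEC at `(y, T₀ + Δ, j)`:
* **`glued_deep_decAtT`** — the deep transfer; **`glued_deepPair_decAtT`** — for the TIGHT pair `{l, h; pairGate y T₀ l h}` of a compatible mid pair
  (`2l < T₀ < l + h`), light or heavy (`decAtT_single` + `validAt_creditPair`).
* **`gluedPullback_deepPair`** — weak duality: for every price system `(α, p)` of the positions at `(y, T, j)` with `T ≤ T₀ + m`, every deep compatible mid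
  pair (`l < h ≤ j − r − k`, `h ≤ B`, `2l < T₀ < l + h`) satisfies `(1−γ)Ψ(l) + γΨ(h) ≤ 0`, `γ = pairGate y T₀ l h`; **`gluedPullback_deepPair_usage`** — the
  same as the pair condition `Ψ(l) ≤ usage y T₀ J l h · (−Ψ(h))` of the first factor at any layer `J ≥ h`.
STATE OF THE SINGLE-LAYER ROUTE after this file and `…QuantGluedTransfer` (memo §2): with `J = max(j − r − k, h_c)` (`h_c` the largest cheap atom) the
conditions "Ψ is a price system of `gate β a` at `(ax, aS, J)`" hold for: all absorbers (`gluedPullback_nonpos`), all giants above `j`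
(`gluedPullback_giantPair`; the giants in `(J, j]` by the choice of `h_c`), all heavy mid pairs (`gluedPullback_heavyPair`), all DEEP mid pairs (here).
OPEN: the LIGHT WINDOW pairs `j − r − k < h ≤ h_c` (LEMMA W analogue: a transferred image using the cheap atom) and the gate row for `a < 1`.

HONEST STATUS.  `GluedDominated`, the band, `SiblingStep`, `FarTreeRow` OPEN; RATE class (log\*) / honest sentence unchanged.  [this work].  Nothing here is cited as
a published result.  The gluing rows served [cite: KozmaNitzan2024, Conjecture 3 (p. 15)]; product measure [cite: Grimmett1999, §1.3 p. 10].
-/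

noncomputable section

open scoped BigOperators

namespace Summit.CriticalPhenomena.PercolationContinuityZ3.Theorems
namespace Quant

open Finset

namespace LawDec

/-- the point mass `δ_K` -/
local notation3 "δ[" K "]" => (fun k : ℕ => if k = (K : ℕ) then (1 : ℝ) else 0)

/-- the two-point law `{lo, lo+K; g}` = `lo` sure relays and a blob of size `K` at gate `g` -/
local notation3 "TPL[" lo ", " K ", " g "]" => lconv lo K δ[lo] (gate δ[K] g)

/-- the two-point law `{lo, hi; g}` evaluated at `h` (as in `…QuantLawDEC`) -/
local notation3 "TP[" lo ", " hi ", " g ", " h "]" =>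
  (g : ℝ) * (if (h : ℕ) = (hi : ℕ) then (1 : ℝ) else 0) + (1 - (g : ℝ)) * (if (h : ℕ) = (lo : ℕ) then (1 : ℝ) else 0)

/-! ### The deep transfer -/

/-- **DEEP TRANSFER.**  `C` a law vanishing above `h ≤ B`, DEC at `(y, T₀)` at the no-giant layer `h`; `t` the glued law with `0 < y ≤ qg`,
`y(r+k) ≤ m = q(r+kg)`; `Δ ≤ m`; `h + (r+k) ≤ j`.  Then `C ∗ t` is DEC at `(y, T₀ + Δ, j)` on `{0..B+(r+k)}` (`lconv_decAtT_noGiant` with `decAtT_glued`).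
[this work] -/
theorem glued_deep_decAtT (y q g T₀ Δ : ℝ) (r k j h B : ℕ) (C : ℕ → ℝ) (hy0 : 0 < y) (hy1 : y < 1) (hq0 : 0 < q) (hq1 : q ≤ 1)
    (hg0 : 0 ≤ g) (hg1 : g ≤ 1) (hyqg : y ≤ q * g) (haff : y * ((r : ℝ) + k) ≤ q * ((r : ℝ) + k * g))
    (hCM : ∀ u, h < u → C u = 0) (hC : DECAtT y T₀ h h C) (hdeep : h + (r + k) ≤ j) (hhB : h ≤ B)
    (hΔ : Δ ≤ q * ((r : ℝ) + k * g)) :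
    DECAtT y (T₀ + Δ) j (B + (r + k)) (lconv B (r + k) C (gate (TPL[r, k, g]) q)) := by
  have ht : DECAtT y Δ (r + k) (r + k) (gate (TPL[r, k, g]) q) := decAtT_glued y q g Δ r k (r + k) hy0 hy1 hq0 hq1 hg0 hg1 hyqg haff hΔ
  have hc := lconv_decAtT_noGiant y T₀ Δ h (r + k) j h (r + k) C (gate (TPL[r, k, g]) q) hy0 hy1 hCM le_rfl le_rfl hdeep hC ht
  have e : lconv B (r + k) C (gate (TPL[r, k, g]) q) = lconv h (r + k) C (gate (TPL[r, k, g]) q) :=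
    funext fun u => lconv_top_left_of_le h B (r + k) C _ hhB hCM u
  rw [e]
  exact decAtT_mono_top hc (by omega)

/-- **the tight pair of a compatible mid pair transfers when deep**: `l < h`, `2l < T₀ < l + h`, `γ = pairGate y T₀ l h` (light or heavy), `h + (r+k) ≤ j`,
`h ≤ B`, `Δ ≤ m` ⟹ `{l, h; γ} ∗ t` is DEC at `(y, T₀ + Δ, j)`. [this work] -/
theorem glued_deepPair_decAtT (y q g T₀ Δ : ℝ) (r k j l h B : ℕ) (hy0 : 0 < y) (hy1 : y < 1) (hq0 : 0 < q) (hq1 : q ≤ 1)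
    (hg0 : 0 ≤ g) (hg1 : g ≤ 1) (hyqg : y ≤ q * g) (haff : y * ((r : ℝ) + k) ≤ q * ((r : ℝ) + k * g))
    (hlh : l < h) (hlow : 2 * (l : ℝ) < T₀) (hcomp : T₀ < (l : ℝ) + h) (hdeep : h + (r + k) ≤ j) (hhB : h ≤ B)
    (hΔ : Δ ≤ q * ((r : ℝ) + k * g)) :
    DECAtT y (T₀ + Δ) j (B + (r + k))
      (lconv B (r + k) (fun i => TP[l, h, pairGate y T₀ l h, i]) (gate (TPL[r, k, g]) q)) := by
  set γ : ℝ := pairGate y T₀ l h with hγ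
  have hγ0 : 0 < γ := pairGate_pos y T₀ l h hlow hlh
  have hγ1 : γ < 1 := pairGate_lt_one y T₀ l h hy0 hy1 hlow hcomp
  have hval : ValidAt y T₀ h l h γ :=
    validAt_creditPair y T₀ ((T₀ - 2 * (l : ℝ)) / ((h : ℝ) - l)) γ h l h hlh le_rfl hy1 rfl (by rw [hγ]; rfl)
  have hC : DECAtT y T₀ h h (fun i => TP[l, h, γ, i]) := decAtT_single y T₀ h h l h γ ⟨hγ0.le, hγ1.le⟩ hlh.le le_rfl hval
  have hCM : ∀ u, h < u → TP[l, h, γ, u] = 0 := fun u hu => by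
    rw [if_neg (by omega), if_neg (by omega)]; ring
  exact glued_deep_decAtT y q g T₀ Δ r k j h B _ hy0 hy1 hq0 hq1 hg0 hg1 hyqg haff hCM hC hdeep hhB hΔ

/-! ### Consequences for the pullback -/

/-- **THE DEEP PAIR CONDITION.**  For a price system `(α, p)` of the positions `{0..B+(r+k)}` at `(y, T, j)` (`0 < y ≤ qg`, `y(r+k) ≤ m`) and a real
`T₀` with `T ≤ T₀ + m`: every DEEP compatible mid pair (`l < h`, `h + r + k ≤ j`, `h ≤ B`, `2l < T₀ < l + h`) satisfies
`(1−γ)·Ψ(l) + γ·Ψ(h) ≤ 0` with `γ = pairGate y T₀ l h` and `Ψ = gluedPullback T q g j r k α p`. [this work] -/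
theorem gluedPullback_deepPair (y q g T T₀ : ℝ) (r k j B l h : ℕ) (α p : ℕ → ℝ) (hy0 : 0 < y) (hy1 : y < 1) (hq0 : 0 < q) (hq1 : q ≤ 1)
    (hg0 : 0 ≤ g) (hg1 : g ≤ 1) (hr : 1 ≤ r) (hyqg : y ≤ q * g) (haff : y * ((r : ℝ) + k) ≤ q * ((r : ℝ) + k * g))
    (hjM : j < B + (r + k)) (hT : T ≤ T₀ + q * ((r : ℝ) + k * g)) (hlh : l < h) (hdeep : h + r + k ≤ j) (hhB : h ≤ B)
    (hlow : 2 * (l : ℝ) < T₀) (hcomp : T₀ < (l : ℝ) + h) (hp : ∀ h, 0 ≤ p h)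
    (hαp : ∀ l h, l ≤ j → 2 * (l : ℝ) < T → h ≤ B + (r + k) → (j + 1 ≤ h ∨ T < (l : ℝ) + h) → α l ≤ usage y T j l h * p h) :
    (1 - pairGate y T₀ l h) * gluedPullback T q g j r k α p l + pairGate y T₀ l h * gluedPullback T q g j r k α p h ≤ 0 := by
  set γ : ℝ := pairGate y T₀ l h with hγ
  have hdec := glued_deepPair_decAtT y q g T₀ (T - T₀) r k j l h B hy0 hy1 hq0 hq1 hg0 hg1 hyqg haff hlh hlow hcomp (by omega) hhB (by linarith)
  rw [show T₀ + (T - T₀) = T by ring] at hdec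
  have eC : (fun i => TP[l, h, γ, i]) = fun i => γ * δ[h] i + (1 - γ) * δ[l] i := funext fun i => rfl
  rw [← hγ, eC] at hdec
  have := glued_image_dual_le y q g T r k j B _ α p hy0 hy1 hr hjM.le hdec hp hαp
  rwa [sum_pair_gluedPullback B l h γ _ (by omega) hhB] at this

/-- from `(1−γ)a + γb ≤ 0` with `0 ≤ γ < 1` to `a ≤ γ/(1−γ)·(−b)`. [folklore] -/
theorem le_usage_of_pair_le (γ a b : ℝ) (hγ1 : γ < 1) (h : (1 - γ) * a + γ * b ≤ 0) : a ≤ γ / (1 - γ) * (-b) := by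
  have h1 : 0 < 1 - γ := by linarith
  rw [div_mul_eq_mul_div, le_div_iff₀ h1]
  nlinarith

/-- **THE DEEP PAIR CONDITION IN USAGE FORM**: under the hypotheses of `gluedPullback_deepPair`, for every layer `J ≥ h` of the first factor,
`Ψ(l) ≤ usage y T₀ J l h · (−Ψ(h))` — the pair condition of a price system at `(y, T₀, J)`. [this work] -/
theorem gluedPullback_deepPair_usage (y q g T T₀ : ℝ) (r k j B l h J : ℕ) (α p : ℕ → ℝ) (hy0 : 0 < y) (hy1 : y < 1) (hq0 : 0 < q)
    (hq1 : q ≤ 1) (hg0 : 0 ≤ g) (hg1 : g ≤ 1) (hr : 1 ≤ r) (hyqg : y ≤ q * g) (haff : y * ((r : ℝ) + k) ≤ q * ((r : ℝ) + k * g))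
    (hjM : j < B + (r + k)) (hT : T ≤ T₀ + q * ((r : ℝ) + k * g)) (hlh : l < h) (hdeep : h + r + k ≤ j) (hhB : h ≤ B) (hhJ : h ≤ J)
    (hlow : 2 * (l : ℝ) < T₀) (hcomp : T₀ < (l : ℝ) + h) (hp : ∀ h, 0 ≤ p h)
    (hαp : ∀ l h, l ≤ j → 2 * (l : ℝ) < T → h ≤ B + (r + k) → (j + 1 ≤ h ∨ T < (l : ℝ) + h) → α l ≤ usage y T j l h * p h) :
    gluedPullback T q g j r k α p l ≤ usage y T₀ J l h * (- gluedPullback T q g j r k α p h) := by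
  have hpair := gluedPullback_deepPair y q g T T₀ r k j B l h α p hy0 hy1 hq0 hq1 hg0 hg1 hr hyqg haff hjM hT hlh hdeep hhB hlow hcomp hp hαp
  have hγ1 : pairGate y T₀ l h < 1 := pairGate_lt_one y T₀ l h hy0 hy1 hlow hcomp
  have hu : usage y T₀ J l h = pairGate y T₀ l h / (1 - pairGate y T₀ l h) := by
    have hnj : ¬ (J + 1 ≤ h) := by omega
    simp only [usage, gateOf, if_neg hnj]
  rw [hu]
  exact le_usage_of_pair_le _ _ _ hγ1 hpair

/-- **THE HEAVY PAIR CONDITION IN USAGE FORM** (from `gluedPullback_heavyPair`, any position): for a compatible mid pair `l < h ≤ B`, `2l < T₀ < l + h`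
whose minimal gate is HEAVY (`y ≤ pairGate y T₀ l h`), `T ≤ T₀ + m`, `l ≤ j`, and every layer `J ≥ h`:
`Ψ(l) ≤ usage y T₀ J l h · (−Ψ(h))`. [this work] -/
theorem gluedPullback_heavyPair_usage (y q g T T₀ : ℝ) (r k j B l h J : ℕ) (α p : ℕ → ℝ) (hy0 : 0 < y) (hy1 : y < 1) (hq0 : 0 < q)
    (hq1 : q ≤ 1) (hg0 : 0 ≤ g) (hg1 : g ≤ 1) (hr : 1 ≤ r) (hyqg : y ≤ q * g) (haff : y * ((r : ℝ) + k) ≤ q * ((r : ℝ) + k * g))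
    (hjM : j < B + (r + k)) (hT : T ≤ T₀ + q * ((r : ℝ) + k * g)) (hlh : l < h) (hlj : l ≤ j) (hhB : h ≤ B) (hhJ : h ≤ J)
    (hlow : 2 * (l : ℝ) < T₀) (hcomp : T₀ < (l : ℝ) + h) (hheavy : y ≤ pairGate y T₀ l h) (hp : ∀ h, 0 ≤ p h)
    (hαp : ∀ l h, l ≤ j → 2 * (l : ℝ) < T → h ≤ B + (r + k) → (j + 1 ≤ h ∨ T < (l : ℝ) + h) → α l ≤ usage y T j l h * p h) :
    gluedPullback T q g j r k α p l ≤ usage y T₀ J l h * (- gluedPullback T q g j r k α p h) := by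
  set γ : ℝ := pairGate y T₀ l h with hγ
  have hγ1 : γ < 1 := pairGate_lt_one y T₀ l h hy0 hy1 hlow hcomp
  obtain ⟨K, hK⟩ : ∃ K, h = l + K := ⟨h - l, by omega⟩
  -- a heavy minimal gate is the plain ratio: γ = (T₀ − 2l)/(h − l), so T₀ = 2l + Kγ
  have hd : (0 : ℝ) < (h : ℝ) - l := by
    have : (l : ℝ) < h := by exact_mod_cast hlh
    linarith
  have hγρ : γ = (T₀ - 2 * (l : ℝ)) / ((h : ℝ) - l) := by
    rw [hγ]
    unfold pairGate
    refine max_eq_left ?_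
    have hρ : y ≤ (T₀ - 2 * (l : ℝ)) / ((h : ℝ) - l) := by
      by_contra hc
      have hlt := not_le.1 hc
      have : pairGate y T₀ l h < y := by
        unfold pairGate
        refine max_lt hlt ?_
        nlinarith
      linarith
    nlinarith
  have hT0 : T₀ = 2 * (l : ℝ) + (K : ℝ) * γ := by
    rw [hγρ, hK]; push_cast
    have : ((l : ℝ) + K - l) = K := by ring
    rw [this]
    have hK0 : (0 : ℝ) < K := by
      have : (1 : ℕ) ≤ K := by omega
      exact_mod_cast Nat.lt_of_lt_of_le Nat.zero_lt_one this
    field_simp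
    ring
  have hpair := gluedPullback_heavyPair y q g T γ r k j B l K α p hy0 hy1 hq0 hq1 hg0 hg1 hr hyqg haff hjM hheavy hγ1.le hlj
    (by omega) (by rw [← hT0]; linarith) hp hαp
  rw [← hK] at hpair
  have hu : usage y T₀ J l h = γ / (1 - γ) := by
    have hnj : ¬ (J + 1 ≤ h) := by omega
    simp only [usage, gateOf, if_neg hnj, hγ]
  rw [hu]
  exact le_usage_of_pair_le _ _ _ hγ1 hpair

/-- **THE GIANT CONDITION ABOVE `j` IN USAGE FORM** (from `gluedPullback_giantPair` at `γ = y`): for `j < h ≤ B`, `l ≤ B` and every layer `J < h`,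
`Ψ(l) ≤ usage y T₀ J l h · (−Ψ(h)) = y/(1−y)·(−Ψ(h))`. [this work] -/
theorem gluedPullback_giant_usage (y q g T T₀ : ℝ) (r k j B l h J : ℕ) (α p : ℕ → ℝ) (hy0 : 0 < y) (hy1 : y < 1) (hq0 : 0 < q)
    (hq1 : q ≤ 1) (hg0 : 0 ≤ g) (hg1 : g ≤ 1) (hr : 1 ≤ r) (hjM : j < B + (r + k)) (hlB : l ≤ B) (hhB : h ≤ B) (hjh : j < h) (hJh : J + 1 ≤ h)
    (hp : ∀ h, 0 ≤ p h)
    (hαp : ∀ l h, l ≤ j → 2 * (l : ℝ) < T → h ≤ B + (r + k) → (j + 1 ≤ h ∨ T < (l : ℝ) + h) → α l ≤ usage y T j l h * p h) :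
    gluedPullback T q g j r k α p l ≤ usage y T₀ J l h * (- gluedPullback T q g j r k α p h) := by
  have hpair := gluedPullback_giantPair y q g T y r k j B l h α p hy0 hy1 hq0 hq1 hg0 hg1 hr hjM le_rfl hy1.le hlB hhB hjh hp hαp
  rw [usage_giant_eq y T₀ J l h hJh]
  exact le_usage_of_pair_le _ _ _ hy1 hpair

end LawDec
end Quant
end Summit.CriticalPhenomena.PercolationContinuityZ3.Theorems
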